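import Mathlib
import HarnessLib

/-!
# Hardy's inequality, classical form, `L²` case: the Cesàro average `x⁻¹ ∫₀ˣ f` on `(0, ∞)`

Topic `Analysis/FunctionSpaces` (support file: theorems only, no definitions, no named facts).
RH-FREE classical real analysis. For a non-negative measurable `f ∈ L²(0,∞)` put
`(Qf)(x) = x⁻¹ ∫₀ˣ f(u) du`. Then `Qf` is square-integrable on `(0,∞)` and
`∫₀^∞ (Qf)(x)² dx ≤ 4 ∫₀^∞ f²` — Hardy's inequality with `p = 2` (Hardy–Littlewood–Pólya, Thm. 327;
the integral analogue (5) of "Hardy's Inequality" in Bullen's *Dictionary of Inequalities*,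
`∫₀^∞ (x⁻¹∫₀ˣ f)ᵖ dx ≤ (p/(p−1))ᵖ ∫₀^∞ fᵖ`). The constant `4 = (p/(p−1))ᵖ` is Hardy's; its optimality
is not claimed here. Companion of `HardyInequalityTail.lean` (the dual/Copson form for the tail average
`∫ₓ^∞ f(u)du/u`); the two averaging operators are exchanged by the Fourier cosine transform and carry
the Mellin multipliers `1/s` and `1/(1−s)` respectively (Burnol 2004b §4, the factor `s/(s−1)`).

Proof (weighted Cauchy–Schwarz and Tonelli): for `x > 0`,
`(∫₀ˣ f)² = (∫₀ˣ (f u^{1/4})·u^{−1/4})² ≤ (∫₀ˣ f² u^{1/2}) · (∫₀ˣ u^{−1/2}) = 2x^{1/2} ∫₀ˣ f²u^{1/2}`, so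
`(Qf)(x)² ≤ 2x^{−3/2}∫₀ˣ f(u)²u^{1/2}du`, and
`∫₀^∞ 2x^{−3/2} ∫₀ˣ f(u)²u^{1/2} du dx = ∫₀^∞ f(u)² u^{1/2} (∫_u^∞ 2x^{−3/2} dx) du = ∫₀^∞ f(u)² u^{1/2}·4u^{−1/2} du = 4∫₀^∞ f²`.

## References

* G. H. Hardy, J. E. Littlewood, G. Pólya, *Inequalities*, 2nd ed., Cambridge 1952, §9.8, Thm. 327
  (pp. 239–243). [key `HardyLittlewoodPolya1952`]
* P. S. Bullen, *A Dictionary of Inequalities*, Chapman & Hall/CRC (1998), "Hardy's Inequality",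
  Integral analogues (5) (held copy, chunk p0087).
-/

noncomputable section

open MeasureTheory Set Filter
open scoped ENNReal Topology

namespace Literature.Analysis.FunctionSpaces

namespace HardyAverage

/-- `∫ₓ^∞ u^{−3/2} du = 2 x^{−1/2}` for `x > 0`. [folklore] -/
private theorem integral_Ioi_rpow_neg_three_halves {t : ℝ} (ht : 0 < t) :
    ∫ u in Ioi t, u ^ (-(3 / 2 : ℝ)) = 2 * t ^ (-(1 / 2 : ℝ)) := by
  rw [integral_Ioi_rpow_of_lt (by norm_num) ht, show (-(3 / 2 : ℝ) + 1) = -(1 / 2) by norm_num]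
  ring

/-- `∫₀ˣ u^{−1/2} du = 2 x^{1/2}` as a set integral over `(0,x)`, with integrability (`x > 0`). [folklore] -/
private theorem setIntegral_Ioo_rpow_neg_half {x : ℝ} (hx : 0 < x) :
    IntegrableOn (fun u : ℝ ↦ u ^ (-(1 / 2 : ℝ))) (Ioo 0 x) ∧
      ∫ u in Ioo 0 x, u ^ (-(1 / 2 : ℝ)) = 2 * x ^ (1 / 2 : ℝ) := by
  have hint : IntervalIntegrable (fun u : ℝ ↦ u ^ (-(1 / 2 : ℝ))) volume 0 x :=
    intervalIntegral.intervalIntegrable_rpow' (by norm_num)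
  refine ⟨((intervalIntegrable_iff_integrableOn_Ioc_of_le hx.le).1 hint).mono_set
    Ioo_subset_Ioc_self, ?_⟩
  rw [← integral_Ioc_eq_integral_Ioo, ← intervalIntegral.integral_of_le hx.le,
    integral_rpow (Or.inl (by norm_num)), Real.zero_rpow (by norm_num), sub_zero,
    show (-(1 / 2 : ℝ) + 1) = 1 / 2 by norm_num]
  ring

/-- `(u^{−1/4})² = u^{−1/2}`, `(f u^{1/4})² = f² u^{1/2}`, `f u^{1/4} u^{−1/4} = f` (`u > 0`). [folklore] -/
private theorem rpow_aux {u : ℝ} (hu : 0 < u) (y : ℝ) :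
    (u ^ (-(1 / 4 : ℝ))) ^ 2 = u ^ (-(1 / 2 : ℝ)) ∧
      (y * u ^ (1 / 4 : ℝ)) ^ 2 = y ^ 2 * u ^ (1 / 2 : ℝ) ∧
      y * u ^ (1 / 4 : ℝ) * u ^ (-(1 / 4 : ℝ)) = y := by
  refine ⟨?_, ?_, ?_⟩
  · rw [← Real.rpow_natCast, ← Real.rpow_mul hu.le]; norm_num
  · rw [mul_pow, ← Real.rpow_natCast (u ^ (1 / 4 : ℝ)), ← Real.rpow_mul hu.le]; norm_num
  · rw [mul_assoc, ← Real.rpow_add hu, show ((1 / 4 : ℝ) + -(1 / 4)) = 0 by norm_num,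
      Real.rpow_zero, mul_one]

/-- **Pointwise weighted Cauchy–Schwarz**: for `x > 0` and a non-negative measurable `f ∈ L²(0,∞)`,
`f` and `f²u^{1/2}` are integrable on `(0,x)` and `(∫₀ˣ f)² ≤ 2x^{1/2} ∫₀ˣ f(u)² u^{1/2} du`.
[cite: HardyLittlewoodPolya1952, Thm. 327 (proof)] -/
theorem sq_integral_le {f : ℝ → ℝ} (hfm : Measurable f) (hf0 : ∀ u, 0 ≤ f u)
    (hf : MemLp f 2 (volume.restrict (Ioi 0))) {x : ℝ} (hx : 0 < x) :
    IntegrableOn f (Ioo 0 x) ∧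
      IntegrableOn (fun u ↦ f u ^ 2 * u ^ (1 / 2 : ℝ)) (Ioo 0 x) ∧
      (∫ u in Ioo 0 x, f u) ^ 2 ≤ 2 * x ^ (1 / 2 : ℝ) * ∫ u in Ioo 0 x, f u ^ 2 * u ^ (1 / 2 : ℝ) := by
  have hfx : MemLp f 2 (volume.restrict (Ioo 0 x)) :=
    hf.mono_measure (Measure.restrict_mono Ioo_subset_Ioi_self le_rfl)
  have hu : ∀ᵐ u ∂(volume.restrict (Ioo 0 x)), u ∈ Ioo 0 x := ae_restrict_mem measurableSet_Ioo
  set w₁ : ℝ → ℝ := fun u ↦ f u * u ^ (1 / 4 : ℝ) with hw₁def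
  set w₂ : ℝ → ℝ := fun u ↦ u ^ (-(1 / 4 : ℝ)) with hw₂def
  have hw₁m : Measurable w₁ := hfm.mul (measurable_id.pow_const _)
  have hw₂m : Measurable w₂ := measurable_id.pow_const _
  have h2 : ENNReal.ofReal (2 : ℝ) = 2 := by norm_num
  -- `w₂² = u^{−1/2}` integrable on `(0,x)`
  have hw₂ : MemLp w₂ 2 (volume.restrict (Ioo 0 x)) := by
    refine (memLp_two_iff_integrable_sq hw₂m.aestronglyMeasurable).2 ?_
    refine (setIntegral_Ioo_rpow_neg_half hx).1.congr_fun (fun u hu' ↦ ?_) measurableSet_Ioo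
    exact ((rpow_aux hu'.1 0).1).symm
  -- `w₁² = f² u^{1/2} ≤ x^{1/2} f²` integrable on `(0,x)`
  have hf2 : Integrable (fun u ↦ f u ^ 2) (volume.restrict (Ioo 0 x)) :=
    (memLp_two_iff_integrable_sq hfx.1).1 hfx
  have hw₁sq : IntegrableOn (fun u ↦ f u ^ 2 * u ^ (1 / 2 : ℝ)) (Ioo 0 x) := by
    refine (hf2.mul_const (x ^ (1 / 2 : ℝ))).mono' ?_ ?_
    · exact ((hfm.pow_const 2).mul (measurable_id.pow_const _)).aestronglyMeasurable
    · filter_upwards [hu] with u hu'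
      rw [Real.norm_eq_abs, abs_of_nonneg (mul_nonneg (sq_nonneg _) (Real.rpow_nonneg hu'.1.le _))]
      refine mul_le_mul_of_nonneg_left ?_ (sq_nonneg _)
      exact Real.rpow_le_rpow hu'.1.le hu'.2.le (by norm_num)
  have hw₁ : MemLp w₁ 2 (volume.restrict (Ioo 0 x)) := by
    refine (memLp_two_iff_integrable_sq hw₁m.aestronglyMeasurable).2 ?_
    refine hw₁sq.congr_fun (fun u hu' ↦ ?_) measurableSet_Ioo
    exact ((rpow_aux hu'.1 (f u)).2.1).symm
  -- `f = w₁ w₂` on `(0, x)`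
  have hprod : EqOn (fun u ↦ w₁ u * w₂ u) f (Ioo 0 x) :=
    fun u hu' ↦ (rpow_aux hu'.1 (f u)).2.2
  have hint_prod : IntegrableOn (fun u ↦ w₁ u * w₂ u) (Ioo 0 x) := hw₁.integrable_mul hw₂
  have hint_f : IntegrableOn f (Ioo 0 x) := hint_prod.congr_fun hprod measurableSet_Ioo
  refine ⟨hint_f, hw₁sq, ?_⟩
  have hH := integral_mul_le_Lp_mul_Lq_of_nonneg (μ := volume.restrict (Ioo 0 x))
    Real.HolderConjugate.two_two
    (show 0 ≤ᵐ[volume.restrict (Ioo 0 x)] w₁ from by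
      filter_upwards [hu] with u hu'
      exact mul_nonneg (hf0 u) (Real.rpow_nonneg hu'.1.le _))
    (show 0 ≤ᵐ[volume.restrict (Ioo 0 x)] w₂ from by
      filter_upwards [hu] with u hu'
      exact Real.rpow_nonneg hu'.1.le _)
    (by rw [h2]; exact hw₁) (by rw [h2]; exact hw₂)
  have hA : ∫ u in Ioo 0 x, w₁ u ^ (2 : ℝ) = ∫ u in Ioo 0 x, f u ^ 2 * u ^ (1 / 2 : ℝ) := by
    refine setIntegral_congr_fun measurableSet_Ioo fun u hu' ↦ ?_
    rw [Real.rpow_two]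
    exact (rpow_aux hu'.1 (f u)).2.1
  have hB : ∫ u in Ioo 0 x, w₂ u ^ (2 : ℝ) = 2 * x ^ (1 / 2 : ℝ) := by
    rw [← (setIntegral_Ioo_rpow_neg_half hx).2]
    refine setIntegral_congr_fun measurableSet_Ioo fun u hu' ↦ ?_
    rw [Real.rpow_two]
    exact (rpow_aux hu'.1 (f u)).1
  rw [hA, hB] at hH
  rw [← setIntegral_congr_fun measurableSet_Ioo hprod]
  have hI0 : 0 ≤ ∫ u in Ioo 0 x, w₁ u * w₂ u :=
    setIntegral_nonneg measurableSet_Ioo fun u hu' ↦ mul_nonneg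
      (mul_nonneg (hf0 u) (Real.rpow_nonneg hu'.1.le _)) (Real.rpow_nonneg hu'.1.le _)
  have hA0 : 0 ≤ ∫ u in Ioo 0 x, f u ^ 2 * u ^ (1 / 2 : ℝ) :=
    setIntegral_nonneg measurableSet_Ioo fun u hu' ↦
      mul_nonneg (sq_nonneg _) (Real.rpow_nonneg hu'.1.le _)
  have hB0 : 0 ≤ 2 * x ^ (1 / 2 : ℝ) := by positivity
  have hsq : (∫ u in Ioo 0 x, w₁ u * w₂ u) * (∫ u in Ioo 0 x, w₁ u * w₂ u) ≤
      ((∫ u in Ioo 0 x, f u ^ 2 * u ^ (1 / 2 : ℝ)) ^ (1 / (2 : ℝ)) *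
        (2 * x ^ (1 / 2 : ℝ)) ^ (1 / (2 : ℝ))) *
      ((∫ u in Ioo 0 x, f u ^ 2 * u ^ (1 / 2 : ℝ)) ^ (1 / (2 : ℝ)) *
        (2 * x ^ (1 / 2 : ℝ)) ^ (1 / (2 : ℝ))) :=
    mul_self_le_mul_self hI0 hH
  have hroot : ∀ y : ℝ, 0 ≤ y → y ^ (1 / (2 : ℝ)) * y ^ (1 / (2 : ℝ)) = y := by
    intro y hy
    rw [← Real.rpow_add' hy (by norm_num)]
    norm_num
  calc (∫ u in Ioo 0 x, w₁ u * w₂ u) ^ 2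
      = (∫ u in Ioo 0 x, w₁ u * w₂ u) * (∫ u in Ioo 0 x, w₁ u * w₂ u) := sq _
    _ ≤ _ := hsq
    _ = ((∫ u in Ioo 0 x, f u ^ 2 * u ^ (1 / 2 : ℝ)) ^ (1 / (2 : ℝ)) *
          (∫ u in Ioo 0 x, f u ^ 2 * u ^ (1 / 2 : ℝ)) ^ (1 / (2 : ℝ))) *
        ((2 * x ^ (1 / 2 : ℝ)) ^ (1 / (2 : ℝ)) * (2 * x ^ (1 / 2 : ℝ)) ^ (1 / (2 : ℝ))) := by
          ring
    _ = 2 * x ^ (1 / 2 : ℝ) * ∫ u in Ioo 0 x, f u ^ 2 * u ^ (1 / 2 : ℝ) := by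
          rw [hroot _ hA0, hroot _ hB0, mul_comm]

end HardyAverage

open HardyAverage in
/-- **Hardy's inequality, classical form, `L²` case.** For a non-negative measurable `f` with
`f ∈ L²(0, ∞)`, the Cesàro average `(Qf)(x) = x⁻¹∫₀ˣ f` is square-integrable on `(0,∞)` and
`∫₀^∞ (x⁻¹ ∫₀ˣ f)² dx ≤ 4 ∫₀^∞ f²`.
[cite: HardyLittlewoodPolya1952, Thm. 327 (p = 2; §9.8, pp. 239–243)] -/
theorem hardy_average_sq_integral_le {f : ℝ → ℝ} (hfm : Measurable f)
    (hf0 : ∀ u, 0 ≤ f u) (hf : MemLp f 2 (volume.restrict (Ioi 0))) :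
    IntegrableOn (fun x ↦ (x⁻¹ * ∫ u in Ioo 0 x, f u) ^ 2) (Ioi 0) ∧
      ∫ x in Ioi 0, (x⁻¹ * ∫ u in Ioo 0 x, f u) ^ 2 ≤ 4 * ∫ u in Ioi 0, f u ^ 2 := by
  set g : ℝ → ℝ := fun u ↦ f u ^ 2 * u ^ (1 / 2 : ℝ) with hgdef
  have hgm : Measurable g := (hfm.pow_const 2).mul (measurable_id.pow_const _)
  have hf2 : Integrable (fun u ↦ f u ^ 2) (volume.restrict (Ioi 0)) :=
    (memLp_two_iff_integrable_sq hf.1).1 hf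
  have hta : ∀ᵐ x ∂(volume.restrict (Ioi (0 : ℝ))), x ∈ Ioi 0 := ae_restrict_mem measurableSet_Ioi
  -- kernel `K(x,u) = 1_{u<x} 2x^{−3/2} · g(u)`
  set K : ℝ → ℝ → ℝ≥0∞ := fun x u ↦
    (if u < x then ENNReal.ofReal (2 * x ^ (-(3 / 2 : ℝ))) else 0) * ENNReal.ofReal (g u) with hKdef
  have hKm : Measurable (Function.uncurry K) := by
    refine Measurable.mul ?_ ((hgm.comp measurable_snd).ennreal_ofReal)
    refine Measurable.ite (measurableSet_lt measurable_snd measurable_fst) ?_ measurable_const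
    exact ((measurable_fst.pow_const _).const_mul 2).ennreal_ofReal
  -- (1) measurability of `x ↦ ∫₀ˣ f`
  have hPm : StronglyMeasurable (fun x : ℝ ↦ ∫ u in Ioo 0 x, f u) := by
    have hG : StronglyMeasurable
        (Function.uncurry fun (x u : ℝ) ↦ if 0 < u ∧ u < x then f u else 0) := by
      refine Measurable.stronglyMeasurable ?_
      refine Measurable.ite ?_ (hfm.comp measurable_snd) measurable_const
      exact (measurableSet_lt measurable_const measurable_snd).inter
        (measurableSet_lt measurable_snd measurable_fst)
    have h := hG.integral_prod_right (ν := (volume : Measure ℝ))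
    have hfun : (fun x : ℝ ↦ ∫ u in Ioo 0 x, f u) =
        fun x ↦ ∫ u, (fun (x u : ℝ) ↦ if 0 < u ∧ u < x then f u else 0) x u := by
      funext x
      rw [← integral_indicator measurableSet_Ioo]
      refine integral_congr_ae (ae_of_all _ fun u ↦ ?_)
      simp only [indicator, mem_Ioo]
    rw [hfun]
    exact h
  -- (2) pointwise bound and (3) its kernel form
  have hpt : ∀ x ∈ Ioi (0 : ℝ), (x⁻¹ * ∫ u in Ioo 0 x, f u) ^ 2 ≤
      2 * x ^ (-(3 / 2 : ℝ)) * ∫ u in Ioo 0 x, g u := by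
    intro x hx
    have hx' : (0 : ℝ) < x := hx
    have hb := (sq_integral_le hfm hf0 hf hx').2.2
    have hI0 : 0 ≤ ∫ u in Ioo 0 x, g u :=
      setIntegral_nonneg measurableSet_Ioo fun u hu' ↦
        mul_nonneg (sq_nonneg _) (Real.rpow_nonneg hu'.1.le _)
    have hx32 : x ^ (-(3 / 2 : ℝ)) = (x⁻¹) ^ 2 * x ^ (1 / 2 : ℝ) := by
      rw [inv_pow, ← Real.rpow_natCast x 2, ← Real.rpow_neg hx'.le, ← Real.rpow_add hx']
      norm_num
    rw [mul_pow, hx32]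
    calc (x⁻¹) ^ 2 * (∫ u in Ioo 0 x, f u) ^ 2
        ≤ (x⁻¹) ^ 2 * (2 * x ^ (1 / 2 : ℝ) * ∫ u in Ioo 0 x, g u) :=
          mul_le_mul_of_nonneg_left hb (sq_nonneg _)
      _ = 2 * ((x⁻¹) ^ 2 * x ^ (1 / 2 : ℝ)) * ∫ u in Ioo 0 x, g u := by ring
  have hstep : ∀ x ∈ Ioi (0 : ℝ),
      ENNReal.ofReal (2 * x ^ (-(3 / 2 : ℝ)) * ∫ u in Ioo 0 x, g u) = ∫⁻ u in Ioi 0, K x u := by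
    intro x hx
    have hx' : (0 : ℝ) < x := hx
    have hc : 0 ≤ 2 * x ^ (-(3 / 2 : ℝ)) := mul_nonneg zero_le_two (Real.rpow_nonneg hx'.le _)
    have hgi : IntegrableOn g (Ioo 0 x) := (sq_integral_le hfm hf0 hf hx').2.1
    have h1 : ∫ u in Ioo 0 x, g u = ∫ u in Ioi 0, (Iio x).indicator g u := by
      rw [setIntegral_indicator measurableSet_Iio, Ioi_inter_Iio]
    have hgi' : Integrable (fun u ↦ 2 * x ^ (-(3 / 2 : ℝ)) * (Iio x).indicator g u)
        (volume.restrict (Ioi 0)) := by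
      refine Integrable.const_mul ?_ _
      rw [integrable_indicator_iff measurableSet_Iio, IntegrableOn,
        Measure.restrict_restrict measurableSet_Iio, Iio_inter_Ioi]
      exact hgi
    have hnn' : 0 ≤ᵐ[volume.restrict (Ioi 0)]
        fun u ↦ 2 * x ^ (-(3 / 2 : ℝ)) * (Iio x).indicator g u := by
      filter_upwards [ae_restrict_mem (μ := (volume : Measure ℝ)) measurableSet_Ioi] with u hu
      have hu0 : (0 : ℝ) < u := hu
      by_cases hux : u ∈ Iio x
      · rw [indicator_of_mem hux]
        exact mul_nonneg hc (mul_nonneg (sq_nonneg _) (Real.rpow_nonneg hu0.le _))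
      · rw [indicator_of_notMem hux, mul_zero]
        exact le_rfl
    rw [h1, ← integral_const_mul, ofReal_integral_eq_lintegral_ofReal hgi' hnn']
    refine lintegral_congr fun u ↦ ?_
    by_cases hux : u < x
    · rw [indicator_of_mem (show u ∈ Iio x from hux), hKdef]
      simp only [if_pos hux]
      exact ENNReal.ofReal_mul hc
    · rw [indicator_of_notMem (show u ∉ Iio x from hux), hKdef]
      simp only [if_neg hux, mul_zero, ENNReal.ofReal_zero, zero_mul]
  -- (4) Tonelli and the exact kernel integral `∫_u^∞ 2x^{−3/2} dx = 4u^{−1/2}`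
  have hswap : ∫⁻ x in Ioi (0 : ℝ), ∫⁻ u in Ioi (0 : ℝ), K x u =
      ∫⁻ u in Ioi (0 : ℝ), ∫⁻ x in Ioi (0 : ℝ), K x u :=
    lintegral_lintegral_swap hKm.aemeasurable
  have hinner : ∀ u ∈ Ioi (0 : ℝ), ∫⁻ x in Ioi (0 : ℝ), K x u = ENNReal.ofReal (4 * f u ^ 2) := by
    intro u hu
    have hu0 : (0 : ℝ) < u := hu
    have hKu : (fun x ↦ K x u) = fun x ↦
        (Ioi u).indicator (fun x : ℝ ↦ ENNReal.ofReal (2 * x ^ (-(3 / 2 : ℝ)))) x *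
          ENNReal.ofReal (g u) := by
      funext x
      simp only [hKdef, indicator, mem_Ioi]
    have hmeas : Measurable fun x : ℝ ↦
        (Ioi u).indicator (fun x : ℝ ↦ ENNReal.ofReal (2 * x ^ (-(3 / 2 : ℝ)))) x :=
      (((measurable_id.pow_const _).const_mul 2).ennreal_ofReal).indicator measurableSet_Ioi
    have hint : IntegrableOn (fun x : ℝ ↦ 2 * x ^ (-(3 / 2 : ℝ))) (Ioi u) :=
      (integrableOn_Ioi_rpow_of_lt (by norm_num) hu0).const_mul 2
    have hnn : 0 ≤ᵐ[volume.restrict (Ioi u)] fun x : ℝ ↦ 2 * x ^ (-(3 / 2 : ℝ)) := by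
      filter_upwards [ae_restrict_mem (μ := (volume : Measure ℝ)) measurableSet_Ioi] with x hx
      exact mul_nonneg zero_le_two (Real.rpow_nonneg (hu0.trans hx).le _)
    rw [hKu, lintegral_mul_const _ hmeas, lintegral_indicator measurableSet_Ioi,
      Measure.restrict_restrict measurableSet_Ioi, Ioi_inter_Ioi, max_eq_left hu0.le,
      ← ofReal_integral_eq_lintegral_ofReal hint hnn, integral_const_mul,
      integral_Ioi_rpow_neg_three_halves hu0,
      ← ENNReal.ofReal_mul (by positivity : (0 : ℝ) ≤ 2 * (2 * u ^ (-(1 / 2 : ℝ))))]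
    congr 1
    simp only [hgdef]
    have : u ^ (-(1 / 2 : ℝ)) * u ^ (1 / 2 : ℝ) = 1 := by
      rw [← Real.rpow_add hu0]; norm_num
    calc 2 * (2 * u ^ (-(1 / 2 : ℝ))) * (f u ^ 2 * u ^ (1 / 2 : ℝ))
        = 4 * f u ^ 2 * (u ^ (-(1 / 2 : ℝ)) * u ^ (1 / 2 : ℝ)) := by ring
      _ = 4 * f u ^ 2 := by rw [this, mul_one]
  -- (5) the bound in `lintegral` form
  have hM : ∫⁻ x in Ioi (0 : ℝ), ENNReal.ofReal ((x⁻¹ * ∫ u in Ioo 0 x, f u) ^ 2) ≤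
      ENNReal.ofReal (4 * ∫ u in Ioi 0, f u ^ 2) := by
    calc ∫⁻ x in Ioi (0 : ℝ), ENNReal.ofReal ((x⁻¹ * ∫ u in Ioo 0 x, f u) ^ 2)
        ≤ ∫⁻ x in Ioi (0 : ℝ), ∫⁻ u in Ioi (0 : ℝ), K x u := by
          refine lintegral_mono_ae ?_
          filter_upwards [hta] with x hx
          rw [← hstep x hx]
          exact ENNReal.ofReal_le_ofReal (hpt x hx)
      _ = ∫⁻ u in Ioi (0 : ℝ), ∫⁻ x in Ioi (0 : ℝ), K x u := hswap
      _ = ∫⁻ u in Ioi (0 : ℝ), ENNReal.ofReal (4 * f u ^ 2) := by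
          refine lintegral_congr_ae ?_
          filter_upwards [hta] with u hu
          exact hinner u hu
      _ = ENNReal.ofReal (∫ u in Ioi 0, 4 * f u ^ 2) :=
          (ofReal_integral_eq_lintegral_ofReal (hf2.const_mul 4)
            (ae_of_all _ fun u ↦ by positivity)).symm
      _ = ENNReal.ofReal (4 * ∫ u in Ioi 0, f u ^ 2) := by rw [integral_const_mul]
  -- (6) conclusion
  have hnn : 0 ≤ᵐ[volume.restrict (Ioi (0 : ℝ))] fun x ↦ (x⁻¹ * ∫ u in Ioo 0 x, f u) ^ 2 :=
    ae_of_all _ fun x ↦ sq_nonneg _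
  have hPi : IntegrableOn (fun x ↦ (x⁻¹ * ∫ u in Ioo 0 x, f u) ^ 2) (Ioi 0) := by
    refine ⟨((measurable_inv.mul hPm.measurable).pow_const 2).aestronglyMeasurable, ?_⟩
    rw [hasFiniteIntegral_iff_ofReal hnn]
    exact lt_of_le_of_lt hM ENNReal.ofReal_lt_top
  refine ⟨hPi, ?_⟩
  have h4 : 0 ≤ 4 * ∫ u in Ioi 0, f u ^ 2 :=
    mul_nonneg (by norm_num) (setIntegral_nonneg measurableSet_Ioi fun u _ ↦ sq_nonneg _)
  rw [integral_eq_lintegral_of_nonneg_ae hnn hPi.1]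
  exact ENNReal.toReal_le_of_le_ofReal h4 hM

open HardyAverage in
/-- **Hardy's inequality, classical form, complex (normed) values**: for a measurable `φ ∈ L²(0,∞)`,
the Cesàro average `x ↦ x⁻¹∫₀ˣ φ` is square-integrable on `(0,∞)` with
`∫₀^∞ ‖x⁻¹∫₀ˣ φ‖² dx ≤ 4 ∫₀^∞ ‖φ‖²`; `φ` is integrable on each `(0, x)`.
[cite: HardyLittlewoodPolya1952, Thm. 327 (p = 2; §9.8, pp. 239–243)] -/
theorem hardy_average_norm_sq_integral_le {φ : ℝ → ℂ} (hφm : Measurable φ)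
    (hφ : MemLp φ 2 (volume.restrict (Ioi 0))) :
    (∀ x : ℝ, 0 < x → IntegrableOn φ (Ioo 0 x)) ∧
      IntegrableOn (fun x : ℝ ↦ ‖((x : ℝ) : ℂ)⁻¹ * ∫ u in Ioo 0 x, φ u‖ ^ 2) (Ioi 0) ∧
      ∫ x in Ioi (0 : ℝ), ‖((x : ℝ) : ℂ)⁻¹ * ∫ u in Ioo 0 x, φ u‖ ^ 2 ≤
        4 * ∫ u in Ioi 0, ‖φ u‖ ^ 2 := by
  have hfm : Measurable fun u ↦ ‖φ u‖ := hφm.norm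
  have hf : MemLp (fun u ↦ ‖φ u‖) 2 (volume.restrict (Ioi 0)) := hφ.norm
  obtain ⟨hPi, hP⟩ := hardy_average_sq_integral_le hfm (fun u ↦ norm_nonneg _) hf
  have hint : ∀ x : ℝ, 0 < x → IntegrableOn φ (Ioo 0 x) := by
    intro x hx
    have hr := (sq_integral_le hfm (fun u ↦ norm_nonneg _) hf hx).1
    exact hr.mono' hφm.aestronglyMeasurable (ae_of_all _ fun u ↦ le_rfl)
  have hle : ∀ x ∈ Ioi (0 : ℝ),
      ‖((x : ℝ) : ℂ)⁻¹ * ∫ u in Ioo 0 x, φ u‖ ≤ x⁻¹ * ∫ u in Ioo 0 x, ‖φ u‖ := by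
    intro x hx
    have hx' : (0 : ℝ) < x := hx
    rw [norm_mul, norm_inv, Complex.norm_real, Real.norm_eq_abs, abs_of_pos hx']
    exact mul_le_mul_of_nonneg_left (norm_integral_le_integral_norm _) (inv_nonneg.2 hx'.le)
  have hle2 : ∀ᵐ x : ℝ ∂(volume.restrict (Ioi (0 : ℝ))),
      ‖((x : ℝ) : ℂ)⁻¹ * ∫ u in Ioo 0 x, φ u‖ ^ 2 ≤ (x⁻¹ * ∫ u in Ioo 0 x, ‖φ u‖) ^ 2 := by
    filter_upwards [ae_restrict_mem (μ := (volume : Measure ℝ)) measurableSet_Ioi] with x hx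
    rw [sq, sq]
    exact mul_self_le_mul_self (norm_nonneg _) (hle x hx)
  have hPm : StronglyMeasurable (fun x : ℝ ↦ ∫ u in Ioo 0 x, φ u) := by
    have hG : StronglyMeasurable
        (Function.uncurry fun (x u : ℝ) ↦ if 0 < u ∧ u < x then φ u else 0) := by
      refine Measurable.stronglyMeasurable ?_
      refine Measurable.ite ?_ (hφm.comp measurable_snd) measurable_const
      exact (measurableSet_lt measurable_const measurable_snd).inter
        (measurableSet_lt measurable_snd measurable_fst)
    have h := hG.integral_prod_right (ν := (volume : Measure ℝ))
    have hfun : (fun x : ℝ ↦ ∫ u in Ioo 0 x, φ u) =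
        fun x ↦ ∫ u, (fun (x u : ℝ) ↦ if 0 < u ∧ u < x then φ u else 0) x u := by
      funext x
      rw [← integral_indicator measurableSet_Ioo]
      refine integral_congr_ae (ae_of_all _ fun u ↦ ?_)
      simp only [indicator, mem_Ioo]
    rw [hfun]
    exact h
  have hPi' : IntegrableOn (fun x : ℝ ↦ ‖((x : ℝ) : ℂ)⁻¹ * ∫ u in Ioo 0 x, φ u‖ ^ 2) (Ioi 0) := by
    refine hPi.mono' ?_ ?_
    · exact (((Complex.measurable_ofReal.comp measurable_id).inv.mul hPm.measurable).norm.pow_const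
        2).aestronglyMeasurable
    · filter_upwards [hle2] with x hx
      rw [Real.norm_eq_abs, abs_of_nonneg (sq_nonneg _)]
      exact hx
  exact ⟨hint, hPi', le_trans (integral_mono_ae hPi' hPi hle2) hP⟩

end Literature.Analysis.FunctionSpaces
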